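import Literature.RingTheory.Length.MinimalPrimes
import Literature.AlgebraicGeometry.Motives.CyclesEquivalencesProofs
import Literature.AlgebraicGeometry.Dimension.PointDimension
import Mathlib.RingTheory.Flat.TorsionFree
import Mathlib.RingTheory.LocalRing.Length
import Mathlib.RingTheory.TensorProduct.Quotient
import HarnessLib

/-!
# The local identity behind Fulton's Theorem 1.7 (flat pull-back of a principal divisor)

Let `A → B` be a flat local homomorphism of Noetherian local rings with `A` a domain — in the
geometric situation of Fulton, *Intersection Theory*, Theorem 1.7, `A = 𝒪_{W,w}` is the local ring of
a subvariety `W ⊆ Y` at a point `w` and `B = 𝒪_{f⁻¹(W), w'}` that of its inverse image under a flat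
morphism `f : X ⟶ Y` at a point `w'` over `w`. For a rational function `φ = a/b` on `W`
(`a, b ∈ A` nonzero) the coefficient of `f^*[div φ]` at `w'` is
`ord_W(φ)(w) · ℓ_B(B/𝔪_A B)` (the second factor being the multiplicity of the fibre), while the
coefficient of `Σ_η m_η [div φ_η]` — the sum over the irreducible components `V_η` of `f⁻¹(W)`
through `w'`, i.e. over the minimal primes `𝔭` of `B`, with geometric multiplicities
`m_η = ℓ(B_𝔭)` and `φ_η` the pull-back of `φ` to `V_η`, whose local ring at `w'` is `B/𝔭` — is
`Σ_𝔭 ℓ(B_𝔭) · ord_{B/𝔭}(ā/b̄)`. This file proves the equality of the two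
(`Literature.AlgebraicGeometry.Motives.ite_ord_sub_mul_eq_finsum`), orders being Mathlib's
`Ring.ord R x = ℓ_R(R/(x))` at rings of dimension one and `0` otherwise (the junk value of
`Scheme.ord` off codimension one), under the hypothesis that all irreducible components of `Spec B`
have the dimension of `B` (true for the local rings of a scheme all of whose components through the
point have the same dimension, `ringKrullDim_eq_of_forall_minimalPrimes`):

* if `dim B ≥ 2` both sides vanish (no component has dimension one; and `dim A = 1` would force
  `dim B/𝔪_A B ≥ 1`, i.e. infinite fibre multiplicity, by the dimension formula
  `dim B = dim A + dim B/𝔪_A B` for flat local homomorphisms, EGA IV₂ (6.1.2));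
* if `dim A = 0`, `a`, `b` are units and all orders vanish;
* if `dim A = dim B = 1` (the main case): `ℓ_B(B/aB) = ℓ_A(A/aA) · ℓ_B(B/𝔪_A B)` (Fulton Lemma A.4.1,
  Mathlib `IsLocalRing.length_baseChange`; `ord_algebraMap_eq_ord_mul_length`), `a` is `B`-regular
  (flatness), and `ℓ_B(B/aB) = Σ_𝔭 ℓ(B_𝔭) · ℓ_{B/𝔭}((B/𝔭)/(ā))` (Fulton Lemma A.2.7,
  `Literature.RingTheory.Length.ord_eq_finsum_minimalPrimes`).

## References

* W. Fulton, *Intersection Theory*, 2nd ed. (1998), §1.7 (Thm. 1.7, Lemma 1.7.2), App. A.2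
  (Lemma A.2.7), A.4 (Lemma A.4.1).
* A. Grothendieck, J. Dieudonné, EGA IV₂, Cor. (6.1.2) (dimension of flat local homomorphisms).
-/

universe u

open IsLocalRing Order

namespace Literature.AlgebraicGeometry.Motives

/-! ### Dimension bookkeeping -/

/-- If all irreducible components of `Spec R` have the same dimension `d`, i.e. `dim R/p = d` for every
minimal prime `p`, then `dim R = d` (`dim R = sup_𝔮 coht 𝔮` and every prime lies over a minimal one;
Matsumura, *Commutative Ring Theory*, §5). [folklore] -/
theorem ringKrullDim_eq_of_forall_minimalPrimes (R : Type*) [CommRing R] [Nontrivial R]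
    {d : WithBot ℕ∞} (h : ∀ p ∈ minimalPrimes R, ringKrullDim (R ⧸ p) = d) :
    ringKrullDim R = d := by
  obtain ⟨p₀, hp₀⟩ := Ideal.nonempty_minimalPrimes (R := R) (I := ⊥) bot_ne_top
  haveI : p₀.IsPrime := hp₀.1.1
  apply le_antisymm
  · rw [ringKrullDim, krullDim_eq_iSup_coheight]
    refine iSup_le fun q ↦ ?_
    obtain ⟨p, hp, hpq⟩ := Ideal.exists_minimalPrimes_le (J := q.asIdeal) (I := ⊥) bot_le
    haveI : p.IsPrime := hp.1.1
    calc ((coheight q : ℕ∞) : WithBot ℕ∞) ≤ coheight (⟨p, hp.1.1⟩ : PrimeSpectrum R) := by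
          exact_mod_cast coheight_anti ((PrimeSpectrum.asIdeal_le_asIdeal _ _).mp hpq)
      _ = ringKrullDim (R ⧸ p) :=
          Dimension.PrimeSpectrum.coe_coheight_eq_ringKrullDim_quotient _
      _ = d := h p hp
  · rw [← h p₀ hp₀]
    exact ringKrullDim_quotient_le p₀


/-- A Noetherian local ring has a natural number as Krull dimension. [folklore] -/
lemma exists_ringKrullDim_eq_nat (R : Type*) [CommRing R] [IsNoetherianRing R] [IsLocalRing R] :
    ∃ n : ℕ, ringKrullDim R = n := by
  have h1 : ringKrullDim R ≠ ⊤ := ringKrullDim_ne_top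
  have h2 : ringKrullDim R ≠ ⊥ := ringKrullDim_ne_bot
  revert h1 h2
  generalize ringKrullDim R = d
  intro h1 h2
  induction d using WithBot.recBotCoe with
  | bot => exact absurd rfl h2
  | coe d =>
    induction d using ENat.recTopCoe with
    | top => exact absurd rfl h1
    | coe n => exact ⟨n, rfl⟩

variable (A B : Type u) [CommRing A] [CommRing B] [IsLocalRing A] [IsLocalRing B] [Algebra A B]
  [IsLocalHom (algebraMap A B)] [Module.Flat A B]

/-- **Fulton, *Intersection Theory*, Lemma A.4.1, for orders of vanishing**: for a flat local
homomorphism `A → B` of local rings and `a ∈ A`, `ℓ_B(B/aB) = ℓ_A(A/aA) · ℓ_B(B/𝔪_A B)` in `ℕ∞`, i.e.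
`Ring.ord B a = Ring.ord A a · ℓ_B(B/𝔪_A B)` (Mathlib `IsLocalRing.length_baseChange` with `M = A/(a)`,
and `B ⊗_A A/(a) = B/aB`). [cite: Fulton1998, Lemma A.4.1] -/
theorem ord_algebraMap_eq_ord_mul_length (a : A) :
    Ring.ord B (algebraMap A B a) =
      Ring.ord A a * Module.length B (B ⧸ (maximalIdeal A).map (algebraMap A B)) := by
  unfold Ring.ord
  rw [← IsLocalRing.length_baseChange A B (A ⧸ Ideal.span {a}),
    ← (Algebra.TensorProduct.quotIdealMapEquivTensorQuot B (Ideal.span {a})).toLinearEquiv.length_eq,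
    Ideal.map_span, Set.image_singleton]

omit [IsLocalRing A] [IsLocalRing B] [IsLocalHom (algebraMap A B)] in
/-- Under a flat homomorphism from a domain, nonzero elements become non-zero-divisors (Mathlib
`Module.Flat.isSMulRegular_of_nonZeroDivisors`). [folklore] -/
theorem algebraMap_mem_nonZeroDivisors [IsDomain A] {a : A} (ha : a ≠ 0) :
    algebraMap A B a ∈ nonZeroDivisors B := by
  have h := Module.Flat.isSMulRegular_of_nonZeroDivisors (M := B) (mem_nonZeroDivisors_of_ne_zero ha)
  rw [mem_nonZeroDivisors_iff_right]
  intro x hx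
  apply h
  change a • x = a • 0
  rw [smul_zero, Algebra.smul_def, mul_comm]
  exact hx

variable [IsDomain A] [IsNoetherianRing A] [IsNoetherianRing B]

/-- **The local identity behind Fulton's Theorem 1.7.** Let `A → B` be a flat local homomorphism of
Noetherian local rings, `A` a domain, such that every minimal prime `𝔭` of `B` has
`dim B/𝔭 = dim B`, and let `a, b ∈ A` be nonzero. Then, in `ℤ`,
`[dim A = 1] · (ℓ_A(A/(a)) - ℓ_A(A/(b))) · ℓ_B(B/𝔪_A B) = Σ_{𝔭 minimal} ℓ(B_𝔭) · [dim B/𝔭 = 1] · (ℓ((B/𝔭)/(ā)) - ℓ((B/𝔭)/(b̄)))`,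
all lengths finite where they are used and read through `ENat.toNat` (junk `0` for `⊤`, matching the
junk values of `Scheme.ord` and of fibre multiplicities). This is the comparison, at a point of
`f⁻¹(W)`, of the coefficients of `f^*[div(a/b)]` and of `Σ_η m_η [div (a/b)|_{V_η}]` (Fulton,
*Intersection Theory*, proof of Thm. 1.7 via Lemma 1.7.2 and Lemma A.2.7; Stacks 02RE). Cases: `dim B ≥ 2`
(both sides `0`, using the dimension formula for flat local homomorphisms), `dim A = 0` (units),
`dim A = dim B = 1` (Lemma A.4.1 `ord_algebraMap_eq_ord_mul_length` and Lemma A.2.7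
`Literature.RingTheory.Length.ord_eq_finsum_minimalPrimes`). [cite: Fulton1998, Theorem 1.7] -/
theorem ite_ord_sub_mul_eq_finsum (H : ∀ P ∈ minimalPrimes B, ringKrullDim (B ⧸ P) = ringKrullDim B)
    {a b : A} (ha : a ≠ 0) (hb : b ≠ 0) :
    (if ringKrullDim A = 1 then ((Ring.ord A a).toNat : ℤ) - (Ring.ord A b).toNat else 0) *
        (Module.length B (B ⧸ (maximalIdeal A).map (algebraMap A B))).toNat =
      ∑ᶠ P ∈ {P : PrimeSpectrum B | P.asIdeal ∈ minimalPrimes B},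
        ((Module.length (Localization.AtPrime P.asIdeal) (Localization.AtPrime P.asIdeal)).toNat : ℤ) *
          (if ringKrullDim (B ⧸ P.asIdeal) = 1 then
            ((Ring.ord (B ⧸ P.asIdeal) (Ideal.Quotient.mk P.asIdeal (algebraMap A B a))).toNat : ℤ) -
              (Ring.ord (B ⧸ P.asIdeal) (Ideal.Quotient.mk P.asIdeal (algebraMap A B b))).toNat
          else 0) := by
  -- dimensions as natural numbers: `dim B = dim A + dim B/𝔪_A B`
  set I : Ideal B := (maximalIdeal A).map (algebraMap A B) with hI
  have hIle : I ≤ maximalIdeal B := map_maximalIdeal_le (algebraMap A B)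
  have hItop : I ≠ ⊤ := fun h ↦ (maximalIdeal.isMaximal B).ne_top (top_le_iff.mp (h ▸ hIle))
  haveI : Nontrivial (B ⧸ I) := Ideal.Quotient.nontrivial_iff.mpr hItop
  haveI : IsLocalRing (B ⧸ I) := IsLocalRing.of_surjective' (Ideal.Quotient.mk I) Ideal.Quotient.mk_surjective
  obtain ⟨nA, hnA⟩ := exists_ringKrullDim_eq_nat A
  obtain ⟨nB, hnB⟩ := exists_ringKrullDim_eq_nat B
  obtain ⟨nF, hnF⟩ := exists_ringKrullDim_eq_nat (B ⧸ I)
  have hform : nB = nA + nF := by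
    have h := ringKrullDim_eq_add_of_flat_of_isLocalHom A B
    rw [hnA, hnB, ← hI, hnF] at h
    exact_mod_cast h
  have hfin := Literature.RingTheory.Length.finite_setOf_mem_minimalPrimes B
  -- the elements `ā, b̄` of `B/P` and the minimal primes
  have hreg : ∀ {c : A}, c ≠ 0 → algebraMap A B c ∈ nonZeroDivisors B := fun hc ↦
    algebraMap_mem_nonZeroDivisors A B hc
  have hnotMem : ∀ {c : A}, c ≠ 0 → ∀ P ∈ minimalPrimes B, algebraMap A B c ∉ P := fun hc P hP hcP ↦
    notMem_nonZeroDivisors_of_mem_mem_minimalPrimes hcP hP (hreg hc)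
  by_cases hB1 : nB ≤ 1
  · haveI : Ring.KrullDimLE 1 B := by
      rw [Ring.krullDimLE_iff, hnB]; exact_mod_cast hB1
    have hA1 : nA ≤ 1 := by omega
    rcases Nat.le_one_iff_eq_zero_or_eq_one.mp hA1 with hA0 | hA1
    · -- `dim A = 0`: `A` is a field, `a`, `b` are units, all orders vanish
      subst hA0
      haveI : Ring.KrullDimLE 0 A := by rw [Ring.krullDimLE_iff, hnA]
      have hunit : ∀ {c : A}, c ≠ 0 → IsUnit c := fun hc ↦ by
        obtain ⟨y, hy⟩ := (Ring.KrullDimLE.isField_of_isDomain (R := A)).mul_inv_cancel hc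
        exact isUnit_iff_exists_inv.mpr ⟨y, hy⟩
      have hord : ∀ {c : A}, c ≠ 0 → ∀ P : PrimeSpectrum B,
          Ring.ord (B ⧸ P.asIdeal) (Ideal.Quotient.mk P.asIdeal (algebraMap A B c)) = 0 :=
        fun hc P ↦ Ring.ord_of_isUnit (((hunit hc).map (algebraMap A B)).map _)
      rw [if_neg (by rw [hnA]; exact_mod_cast Nat.zero_ne_one), zero_mul,
        finsum_mem_congr rfl (fun P _ ↦ by rw [hord ha P, hord hb P]), ]
      simp only [ENat.toNat_zero, CharP.cast_eq_zero, sub_self, ite_self, mul_zero]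
      exact (finsum_mem_zero _).symm
    · -- the main case: `dim A = 1`, `dim B = 1`, `dim B/𝔪_A B = 0`
      subst hA1
      have hnF0 : nF = 0 := by omega
      have hB : nB = 1 := by omega
      subst hnF0 hB
      haveI : Ring.KrullDimLE 1 A := by rw [Ring.krullDimLE_iff, hnA]
      -- finiteness of the fibre length
      haveI : Ring.KrullDimLE 0 (B ⧸ I) := by rw [Ring.krullDimLE_iff, hnF]
      haveI : IsArtinianRing (B ⧸ I) := isArtinianRing_iff_isNoetherianRing_krullDimLE_zero.mpr
        ⟨inferInstance, inferInstance⟩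
      have hLfin : Module.length B (B ⧸ I) ≠ ⊤ := by
        rw [Module.length_eq_of_surjective (S := B) (R := B ⧸ I) (M := B ⧸ I)
          Ideal.Quotient.mk_surjective]
        exact Module.length_ne_top
      -- the quantities attached to a minimal prime
      have hdimP : ∀ P ∈ {P : PrimeSpectrum B | P.asIdeal ∈ minimalPrimes B},
          ringKrullDim (B ⧸ P.asIdeal) = 1 := fun P hP ↦ by rw [H _ hP, hnB, Nat.cast_one]
      have hmfin : ∀ P ∈ {P : PrimeSpectrum B | P.asIdeal ∈ minimalPrimes B},
          Module.length (Localization.AtPrime P.asIdeal) (Localization.AtPrime P.asIdeal) ≠ ⊤ := by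
        intro P hP
        haveI := Ring.KrullDimLE.of_isLocalization P.asIdeal hP (Localization.AtPrime P.asIdeal)
        haveI : IsArtinianRing (Localization.AtPrime P.asIdeal) :=
          isArtinianRing_iff_isNoetherianRing_krullDimLE_zero.mpr ⟨inferInstance, inferInstance⟩
        exact Module.length_ne_top
      have hofin : ∀ {c : A}, c ≠ 0 → ∀ P ∈ {P : PrimeSpectrum B | P.asIdeal ∈ minimalPrimes B},
          Ring.ord (B ⧸ P.asIdeal) (Ideal.Quotient.mk P.asIdeal (algebraMap A B c)) ≠ ⊤ := by
        intro c hc P hP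
        haveI : Ring.KrullDimLE 1 (B ⧸ P.asIdeal) := by
          rw [Ring.krullDimLE_iff, hdimP P hP, Nat.cast_one]
        refine Ring.ord_ne_top (mem_nonZeroDivisors_of_ne_zero fun h ↦ ?_)
        exact hnotMem hc _ hP (Ideal.Quotient.eq_zero_iff_mem.mp h)
      -- the identity for one element `c`, in `ℕ`
      have key : ∀ {c : A}, c ≠ 0 →
          ((Ring.ord A c).toNat : ℤ) * (Module.length B (B ⧸ I)).toNat =
            ∑ᶠ P ∈ {P : PrimeSpectrum B | P.asIdeal ∈ minimalPrimes B},
              ((Module.length (Localization.AtPrime P.asIdeal)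
                (Localization.AtPrime P.asIdeal)).toNat : ℤ) *
                (Ring.ord (B ⧸ P.asIdeal) (Ideal.Quotient.mk P.asIdeal (algebraMap A B c))).toNat := by
        intro c hc
        have h1 := Literature.RingTheory.Length.ord_eq_finsum_minimalPrimes B (hreg hc)
        rw [ord_algebraMap_eq_ord_mul_length A B c] at h1
        have hcfin : Ring.ord A c ≠ ⊤ := Ring.ord_ne_top (mem_nonZeroDivisors_of_ne_zero hc)
        -- rewrite everything as casts of natural numbers
        rw [finsum_mem_eq_finite_toFinset_sum _ hfin] at h1 ⊢
        rw [← ENat.coe_toNat hcfin, ← ENat.coe_toNat hLfin, ← Nat.cast_mul,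
          Finset.sum_congr rfl (fun P hP ↦ by
            rw [← ENat.coe_toNat (hmfin P (hfin.mem_toFinset.mp hP)),
              ← ENat.coe_toNat (hofin hc P (hfin.mem_toFinset.mp hP)), ← Nat.cast_mul]),
          ← Nat.cast_sum] at h1
        have h2 := Nat.cast_injective (R := ℕ∞) h1
        exact_mod_cast h2
      have hA : ringKrullDim A = 1 := by rw [hnA, Nat.cast_one]
      rw [if_pos hA, finsum_mem_congr rfl (fun P hP ↦ by rw [if_pos (hdimP P hP), mul_sub]),
        finsum_mem_sub_distrib _ _ hfin, ← key ha, ← key hb]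
      ring
  · -- `dim B ≥ 2`: both sides vanish
    have hrhs : ∀ P ∈ {P : PrimeSpectrum B | P.asIdeal ∈ minimalPrimes B},
        ¬ ringKrullDim (B ⧸ P.asIdeal) = 1 := by
      intro P hP h1
      rw [H _ hP, hnB] at h1
      exact hB1 (le_of_eq (by exact_mod_cast h1))
    rw [finsum_mem_congr rfl (fun P hP ↦ by rw [if_neg (hrhs P hP), mul_zero]),
      finsum_mem_zero]
    split_ifs with hA
    · -- `dim A = 1` and `dim B ≥ 2` force `dim B/𝔪_A B ≥ 1`, i.e. infinite length
      suffices hlen : Module.length B (B ⧸ I) = ⊤ by rw [hlen]; simp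
      by_contra hlen
      have hlen' : Module.length (B ⧸ I) (B ⧸ I) ≠ ⊤ := by
        rwa [← Module.length_eq_of_surjective (S := B) (R := B ⧸ I) (M := B ⧸ I)
          Ideal.Quotient.mk_surjective]
      have h0 := ringKrullDim_eq_zero_of_length_ne_top (B ⧸ I) hlen'
      rw [hnF] at h0
      have : nF = 0 := by exact_mod_cast h0
      rw [hnA] at hA
      have : nA = 1 := by exact_mod_cast hA
      omega
    · simp


end Literature.AlgebraicGeometry.Motives
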